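import Literature.RepresentationTheory.TwistedCoinvariants
import HarnessLib

/-!
# Twisted coinvariants: conjugating a twisted intertwiner by two equivariant identifications

Topic `RepresentationTheory`; namespace `Literature.RepresentationTheory.TwistedCoinv` (sequel of `TwistedCoinvariants`, `TwistedCoinvariantsTwoTransports`).
KERNEL ONLY: theorems; no definition, no named fact, no `sorry`.  Cell `hodgecm-mathlib` (D-0151), programme P5 (crux HLiu418 = stmt-HodgeConjecture-24832), piece
**(C4b)-generic** of the road card `F0/P5/A-p18/g23/ROAD-L4if-v3.A-p18g23.md` §8 (A-p18 (g23), 2026-09-01).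

Pure linear algebra, stated for arbitrary modules (the coinvariant spaces of the road are instances): a `c`-twisted intertwiner `E : A ≃ B`
(`E ∘ r_A(g) = c(g) • r_B(g) ∘ E`) and two equivariant identifications `e₁ : A ≃ A′` (over `κ′`), `e₂ : B ≃ B′` (over `κ″`) give
`E′ := e₂ ∘ E ∘ e₁⁻¹ : A′ ≃ B′` with `E′ ∘ r_{A′}(κ′ g) = c(g) • r_{B′}(κ″ g) ∘ E′` (`exists_conj_twisted_intertwiner`).  In the road: `E` = ★ (C4)-core
`exists_coinv_equiv_galConj_similitude`, `e₁, e₂` = ★ (C4a) `exists_coinv_equiv_scaleTransportSection` (reading the transported sections on the members' own models).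
Nothing of the cited sources is asserted; HC_CM is proved only modulo the printed citations until rung 0 closes.

## References
* [GelbartRogawski1991] S. Gelbart, J. Rogawski, Invent. Math. 105 (1991), §3.1 Remark p. 457 L4–13.
* [Liu2021] Y. Liu, App. D §D.1 Step 3 (l. 5221), Lemma D.1 (4) (l. 5235).
-/

set_option autoImplicit false

noncomputable section

namespace Literature.RepresentationTheory.TwistedCoinv

variable {k : Type*} [CommRing k] {G : Type*} {A B A' B' : Type*} [AddCommGroup A] [Module k A] [AddCommGroup B] [Module k B]
  [AddCommGroup A'] [Module k A'] [AddCommGroup B'] [Module k B']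

/-- **Conjugating a twisted intertwiner by two equivariant identifications.** [cite: GelbartRogawski1991, §3.1 Remark p. 457 L4–13]
[cite: Liu2021, App. D §D.1 Step 3 (l. 5221)] -/
theorem exists_conj_twisted_intertwiner (rA : G → A →ₗ[k] A) (rB : G → B →ₗ[k] B) (rA' : G → A' →ₗ[k] A') (rB' : G → B' →ₗ[k] B') (c : G → k)
    (hE : ∃ E : A ≃ₗ[k] B, ∀ (g : G) (x : A), E (rA g x) = c g • rB g (E x))
    (h₁ : ∃ e₁ : A ≃ₗ[k] A', ∀ (g : G) (x : A), e₁ (rA g x) = rA' g (e₁ x))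
    (h₂ : ∃ e₂ : B ≃ₗ[k] B', ∀ (g : G) (y : B), e₂ (rB g y) = rB' g (e₂ y)) :
    ∃ E' : A' ≃ₗ[k] B', ∀ (g : G) (x' : A'), E' (rA' g x') = c g • rB' g (E' x') := by
  obtain ⟨E, hE⟩ := hE
  obtain ⟨e₁, he₁⟩ := h₁
  obtain ⟨e₂, he₂⟩ := h₂
  refine ⟨(e₁.symm.trans E).trans e₂, fun g x' => ?_⟩
  obtain ⟨x, rfl⟩ := e₁.surjective x'
  rw [← he₁, LinearEquiv.trans_apply, LinearEquiv.trans_apply, LinearEquiv.symm_apply_apply, hE, map_smul, he₂, LinearEquiv.trans_apply,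
    LinearEquiv.trans_apply, LinearEquiv.symm_apply_apply]

end Literature.RepresentationTheory.TwistedCoinv

end
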